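import Summits.HodgeConjecture.HodgeConjecture.Theorems.Ring2AbelianAllAndreFibreClassSymmetrySpan
import Literature.AlgebraicGeometry.HodgeTheory.SupportedClassesQuasiFinitePullback
import HarnessLib

/-!
# Ring 2 · sub-cell AbelianAll (ALL ABELIAN VARIETIES), André axis, part XVII-d — THE SYMMETRY BINDER OF PART XVI-f
# MADE GEOMETRIC: an `S`-endomorphism `e` of the pencil (locally quasi-finite, e.g. fibrewise an isogeny) supplies the
# algebraicity-preserving operator `T = e^*` and its fibre operator `E = e_t^*`; (N_p)(t₀), and (β′_f) on the W₆
# habitat, from ONE algebraic cycle in general position for the eigen-decomposition of `e_{t₀}^*` on `I_{2p}(t₀)`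

HONEST FRAMING (page 1, verbatim): **research route, not a corollary; conditional on HC_CM plus one named
minimal statement.** Cell line: research route conditional on HC_CM; not a corollary; Q11.4-sentence-2
already refuted in dim ≥ 3. Nothing in this file proves a case of the Hodge conjecture for an abelian variety.
`HC_CM` = `Theses.RankFourFaces.CMAbelianHodge` does not occur in this file; item `Theses.RankFourFaces.CMToAbelian`
(stmt-16267) OPEN and not closed here. Seat `pub-hodge-ring2-ab-andre-2`, gen 9.

## What is proved (theorems only; no definition, no named fact, no sorry)

Part XVI-f (`algebraicInvariantClassesAt_of_symmetry_of_eigenTriple`) took as BINDERS an endomorphism `T` of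
`H²ᵖ(𝒳(ℂ); ℂ)` preserving algebraic classes and an operator `E` on `H²ᵖ(𝒳_{t₀}(ℂ); ℂ)` with `j_{t₀}^* ∘ T = E ∘ j_{t₀}^*`.
Here both come from GEOMETRY:

§1 `exists_fiberEndo_of_comp_eq` — an `S`-endomorphism `e : 𝒳 ⟶ 𝒳` (`e ≫ f = f`) restricts to every fibre:
there is `e_t : 𝒳_t ⟶ 𝒳_t` with `e_t ≫ j_t = j_t ≫ e` (universal property of the fibre product);
`map_fiberι_map_eq_of_comm` — then `j_t^*(e^* W) = e_t^*(j_t^* W)` (functoriality);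
`map_mem_algebraicClasses_of_endo` — if `e` is locally quasi-finite (e.g. fibrewise an isogeny, or an automorphism)
then `e^*` preserves `N^p(𝒳)` (the tree's quasi-finite pull-back theorem `map_mem_algebraicClasses_of_locallyQuasiFinite`,
both sides the smooth projective `(d+1)`-fold `𝒳`).

§2 **`algebraicInvariantClassesAt_of_endo_of_eigenTriple`** — on a compact pencil of abelian `d`-folds with a locally
quasi-finite `S`-endomorphism `e`, if `I_{2p}(t₀) = j_{t₀}^* H²ᵖ(𝒳)` lies in the span of three eigenvectors of
`e_{t₀}^*` with pairwise distinct eigenvalues and ONE algebraic class `Z ∈ N^p(𝒳)` restricts to `Σ cᵢ vᵢ` with all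
`cᵢ ≠ 0`, then (N_p f)(t₀) (`Z`, `e^* Z`, `e^* e^* Z` are algebraic and their restrictions span the eigenlines —
Lagrange interpolation, part XVI-f).

§3 **`fibreClassLefschetzOn_relDim_six_of_endo_of_eigenTriple`** — the W₆ habitat form: (β′_f) for a compact pencil of
abelian SIXFOLDS with rank-one invariants in degrees 2 and 4 (part XV-e), a locally quasi-finite `S`-endomorphism
whose fibre action has `I₆(t₀)` in the span of an eigen-triple with distinct eigenvalues, and ONE codimension-3
algebraic cycle of the 7-fold `𝒳` in general position. READING (W₆, (W_E)₃ pencils carrying the `ℤ[i]`-action over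
`S`): `e = [1 + i]` is fibrewise an isogeny, `e_{t₀}^*` has eigenvalues `Nm(1+i)³ = 8` on `θ³` and `(1 ± i)⁶ = ∓8i`
on the two Weil eigenlines — pairwise distinct — so **(β′_f) ⟸ ONE codimension-3 algebraic cycle `Z` on `𝒳` whose
restriction to `𝒳_{t₀}` has non-zero components on `θ³`, `w_σ`, `w_σ̄`** with the symmetry binder of part XVI-f /
RING2-MAP AA2.67 now DISCHARGED into "the pencil carries `[1+i]` over `S`" (a property of the habitat, not an extra
hypothesis on cohomology). The eigen-triple clause is the remaining typed input (monodromy `SU(3,3)`: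
`I₆ = ℂθ³ ⊕ W_K`, van Geemen 6.12 — print). No named fact; no Hodge-conjecture input; `HC_CM` absent.

References: Abdulali1994FamiliesAV (Conj. 5.3, Thm. 5.5 p. 1130); vanGeemen1994HodgeAV (4.9, Lemma 5.2, Thm. 6.12);
Andre1996Motifs (§6.3 Lemme 6.3.1); Fulton1998 (§19.2 Cor. 19.2 (b), §1.7); GrothendieckTopology1969 (§1);
Hartshorne1977 (II.3).
-/

noncomputable section

set_option linter.dupNamespace false

namespace Summit.HodgeConjecture.HodgeConjecture.Ring2.AbelianAll

open CategoryTheory AlgebraicGeometry Limits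
open Literature.AlgebraicGeometry Literature.AlgebraicGeometry.Motives
open Literature.AlgebraicGeometry.HodgeTheory

variable {𝒳 S : SchemeOver ℂ}

/-! ## §1 Fibre endomorphisms of an `S`-endomorphism -/

/-- **An `S`-endomorphism restricts to every fibre**: for `e : 𝒳 ⟶ 𝒳` with `e ≫ f = f` and a point `t`, there is
`e_t : 𝒳_t ⟶ 𝒳_t` with `e_t ≫ j_t = j_t ≫ e` (the fibre `𝒳_t = 𝒳 ×_S Spec ℂ` is a fibre product and
`(j_t ≫ e) ≫ f = j_t ≫ f`). [cite: Hartshorne1977, II.3 (fibre of a morphism)] -/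
theorem exists_fiberEndo_of_comp_eq (f : 𝒳 ⟶ S) (e : 𝒳 ⟶ 𝒳) (he : e ≫ f = f) (t : ComplexPoints S) :
    ∃ et : fiberOver f t ⟶ fiberOver f t, et ≫ fiberι f t = fiberι f t ≫ e := by
  have hcond : (pullback.fst f.left t.left ≫ e.left) ≫ f.left = pullback.snd f.left t.left ≫ t.left := by
    rw [Category.assoc, ← Over.comp_left, he, pullback.condition]
  refine ⟨Over.homMk (pullback.lift (pullback.fst f.left t.left ≫ e.left) (pullback.snd f.left t.left) hcond) ?_, ?_⟩
  · change pullback.lift _ _ hcond ≫ pullback.fst f.left t.left ≫ 𝒳.hom = pullback.fst f.left t.left ≫ 𝒳.hom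
    rw [pullback.lift_fst_assoc, Category.assoc, Over.w e]
  · ext : 1
    change pullback.lift _ _ hcond ≫ pullback.fst f.left t.left = pullback.fst f.left t.left ≫ e.left
    rw [pullback.lift_fst]

/-- **`j_t^* ∘ e^* = e_t^* ∘ j_t^*`** for a commuting square `e_t ≫ j_t = j_t ≫ e` (functoriality of `Hᵏ(–(ℂ); ℂ)`).
[cite: Hartshorne1977, II.3] [cite: Fulton1998, §19.2 Cor. 19.2 (b)] -/
theorem map_fiberι_map_eq_of_comm (f : 𝒳 ⟶ S) (e : 𝒳 ⟶ 𝒳) (t : ComplexPoints S)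
    (et : fiberOver f t ⟶ fiberOver f t) (het : et ≫ fiberι f t = fiberι f t ≫ e) (k : ℕ) (W : complexBetti 𝒳 k) :
    complexBetti.map (fiberι f t) k (complexBetti.map e k W) =
      complexBetti.map et k (complexBetti.map (fiberι f t) k W) := by
  rw [← CategoryTheory.comp_apply, ← complexBetti.map_comp, ← het, complexBetti.map_comp,
    CategoryTheory.comp_apply]

/-- **A locally quasi-finite endomorphism of the total space preserves algebraic classes**: `e^* N^p(𝒳) ⊆ N^p(𝒳)`
for `e : 𝒳 ⟶ 𝒳` locally quasi-finite on a compact pencil (the tree's quasi-finite pull-back theorem on the smooth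
projective `(d+1)`-fold `𝒳`; e.g. `e` fibrewise an isogeny, or an automorphism). [cite: Fulton1998, §19.2 Cor. 19.2 (b) and §1.7]
[cite: GrothendieckTopology1969, §1] -/
theorem map_mem_algebraicClasses_of_endo {d : ℕ} {f : 𝒳 ⟶ S} (hf : IsCompactAbelianPencil f d) (e : 𝒳 ⟶ 𝒳)
    [LocallyQuasiFinite e.left] {p : ℕ} {Z : complexBetti 𝒳 (2 * p)} (hZ : Z ∈ algebraicClasses 𝒳 p) :
    complexBetti.map e (2 * p) Z ∈ algebraicClasses 𝒳 p :=
  map_mem_algebraicClasses_of_locallyQuasiFinite hf.isSmoothProjective_total hf.isSmoothProjective_total e hZ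

/-! ## §2 (N_p)(t₀) from an `S`-endomorphism and one algebraic class in general position -/

/-- **(N_p)(t₀) from an `S`-endomorphism with three eigenlines and ONE cycle in general position.** Let `f : 𝒳 ⟶ S`
be a compact pencil of abelian `d`-folds, `e : 𝒳 ⟶ 𝒳` a locally quasi-finite `S`-endomorphism (`e ≫ f = f`) and
`e_{t₀}` its restriction to `𝒳_{t₀}` (any `et` with `et ≫ j_{t₀} = j_{t₀} ≫ e`). Suppose `I_{2p}(t₀) = j_{t₀}^* H²ᵖ(𝒳)`
lies in the span of eigenvectors `v₀, v₁, v₂` of `e_{t₀}^*` with pairwise distinct eigenvalues, and some algebraic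
`Z ∈ N^p(𝒳)` has `j_{t₀}^* Z = Σ cᵢ vᵢ` with all `cᵢ ≠ 0`. Then every class of `I_{2p}(t₀)` is the restriction of an
algebraic class of `𝒳`: (N_p f)(t₀). (Part XVI-f with `T = e^*`, `E = e_{t₀}^*`.) [cite: Abdulali1994FamiliesAV, Theorem 5.5 (p. 1130)]
[cite: vanGeemen1994HodgeAV, Lemma 5.2 and Thm. 6.12] -/
theorem algebraicInvariantClassesAt_of_endo_of_eigenTriple {d : ℕ} {f : 𝒳 ⟶ S} (hf : IsCompactAbelianPencil f d)
    (t₀ : ComplexPoints S) (p : ℕ) (e : 𝒳 ⟶ 𝒳) [LocallyQuasiFinite e.left]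
    (et : fiberOver f t₀ ⟶ fiberOver f t₀) (het : et ≫ fiberι f t₀ = fiberι f t₀ ≫ e)
    (v : Fin 3 → complexBetti (fiberOver f t₀) (2 * p)) (μ : Fin 3 → ℂ)
    (hv : ∀ i, complexBetti.map et (2 * p) (v i) = μ i • v i) (hμ : Function.Injective μ)
    (hspan : ∀ W : complexBetti 𝒳 (2 * p),
      complexBetti.map (fiberι f t₀) (2 * p) W ∈ Submodule.span ℂ (Set.range v))
    {Z : complexBetti 𝒳 (2 * p)} (hZ : Z ∈ algebraicClasses 𝒳 p) (c : Fin 3 → ℂ) (hc : ∀ i, c i ≠ 0)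
    (hz : complexBetti.map (fiberι f t₀) (2 * p) Z = c 0 • v 0 + c 1 • v 1 + c 2 • v 2) :
    AlgebraicInvariantClassesAt hf t₀ p :=
  algebraicInvariantClassesAt_of_symmetry_of_eigenTriple hf t₀ p (complexBetti.map e (2 * p)).hom
    (fun _ hA ↦ map_mem_algebraicClasses_of_endo hf e hA) (complexBetti.map et (2 * p)).hom
    (fun W ↦ map_fiberι_map_eq_of_comm f e t₀ et het (2 * p) W) v μ hv hμ hspan hZ c hc hz

/-- The same with the fibre endomorphism produced from `e ≫ f = f` (§1), the eigen-hypotheses being asked of SOME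
restriction `et` (all restrictions agree on `j_{t₀}^* H²ᵖ(𝒳)` by `map_fiberι_map_eq_of_comm`). [cite: Abdulali1994FamiliesAV, Theorem 5.5 (p. 1130)] -/
theorem algebraicInvariantClassesAt_of_endOver_of_eigenTriple {d : ℕ} {f : 𝒳 ⟶ S} (hf : IsCompactAbelianPencil f d)
    (t₀ : ComplexPoints S) (p : ℕ) (e : 𝒳 ⟶ 𝒳) [LocallyQuasiFinite e.left] (he : e ≫ f = f)
    (h : ∀ et : fiberOver f t₀ ⟶ fiberOver f t₀, et ≫ fiberι f t₀ = fiberι f t₀ ≫ e →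
      ∃ (v : Fin 3 → complexBetti (fiberOver f t₀) (2 * p)) (μ : Fin 3 → ℂ),
        (∀ i, complexBetti.map et (2 * p) (v i) = μ i • v i) ∧ Function.Injective μ ∧
        (∀ W : complexBetti 𝒳 (2 * p),
          complexBetti.map (fiberι f t₀) (2 * p) W ∈ Submodule.span ℂ (Set.range v)) ∧
        ∃ Z ∈ algebraicClasses 𝒳 p, ∃ c : Fin 3 → ℂ, (∀ i, c i ≠ 0) ∧
          complexBetti.map (fiberι f t₀) (2 * p) Z = c 0 • v 0 + c 1 • v 1 + c 2 • v 2) :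
    AlgebraicInvariantClassesAt hf t₀ p := by
  obtain ⟨et, het⟩ := exists_fiberEndo_of_comp_eq f e he t₀
  obtain ⟨v, μ, hv, hμ, hspan, Z, hZ, c, hc, hz⟩ := h et het
  exact algebraicInvariantClassesAt_of_endo_of_eigenTriple hf t₀ p e et het v μ hv hμ hspan hZ c hc hz

/-! ## §3 The W₆ habitat form -/

/-- **(β′_f) on a compact pencil of abelian SIXFOLDS from rank-one invariants in degrees 2, 4, an `S`-endomorphism with
an eigen-triple on `I₆(t₀)`, and ONE codimension-3 algebraic cycle in general position** (part XV-e + §2). W₆ /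
(W_E)₃ reading: `e = [1+i]` over `S`, eigenvalues `8, -8i, 8i` on `θ³, w_σ, w_σ̄`; the cycle `Z` on the 7-fold `𝒳`
must restrict with non-zero components on all three lines. [cite: Abdulali1994FamiliesAV, Conjecture 5.3 and Theorem 5.5 (p. 1130)]
[cite: vanGeemen1994HodgeAV, 4.9 and Thm. 6.12] [cite: Andre1996Motifs, §6.3 Lemme 6.3.1] -/
theorem fibreClassLefschetzOn_relDim_six_of_endo_of_eigenTriple {f : 𝒳 ⟶ S} (hf : IsCompactAbelianPencil f 6)
    (t₀ : ComplexPoints S)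
    (h2 : Module.finrank ℂ (LinearMap.range (complexBetti.map (fiberι f t₀) (2 * 1)).hom) = 1)
    (h4 : Module.finrank ℂ (LinearMap.range (complexBetti.map (fiberι f t₀) (2 * 2)).hom) = 1)
    (e : 𝒳 ⟶ 𝒳) [LocallyQuasiFinite e.left]
    (et : fiberOver f t₀ ⟶ fiberOver f t₀) (het : et ≫ fiberι f t₀ = fiberι f t₀ ≫ e)
    (v : Fin 3 → complexBetti (fiberOver f t₀) (2 * 3)) (μ : Fin 3 → ℂ)
    (hv : ∀ i, complexBetti.map et (2 * 3) (v i) = μ i • v i) (hμ : Function.Injective μ)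
    (hspan : ∀ W : complexBetti 𝒳 (2 * 3),
      complexBetti.map (fiberι f t₀) (2 * 3) W ∈ Submodule.span ℂ (Set.range v))
    {Z : complexBetti 𝒳 (2 * 3)} (hZ : Z ∈ algebraicClasses 𝒳 3) (c : Fin 3 → ℂ) (hc : ∀ i, c i ≠ 0)
    (hz : complexBetti.map (fiberι f t₀) (2 * 3) Z = c 0 • v 0 + c 1 • v 1 + c 2 • v 2) :
    FibreClassLefschetzOn hf :=
  fibreClassLefschetzOn_relDim_six_of_rankOne_of_algebraicInvariantClassesAt_three hf t₀ h2 h4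
    (algebraicInvariantClassesAt_of_endo_of_eigenTriple hf t₀ 3 e et het v μ hv hμ hspan hZ c hc hz)

/-- The same for an `S`-endomorphism given with `e ≫ f = f` (the fibre endomorphism is produced by §1).
[cite: Abdulali1994FamiliesAV, Conjecture 5.3 (p. 1130)] [cite: vanGeemen1994HodgeAV, Thm. 6.12] -/
theorem fibreClassLefschetzOn_relDim_six_of_endOver_of_eigenTriple {f : 𝒳 ⟶ S} (hf : IsCompactAbelianPencil f 6)
    (t₀ : ComplexPoints S)
    (h2 : Module.finrank ℂ (LinearMap.range (complexBetti.map (fiberι f t₀) (2 * 1)).hom) = 1)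
    (h4 : Module.finrank ℂ (LinearMap.range (complexBetti.map (fiberι f t₀) (2 * 2)).hom) = 1)
    (e : 𝒳 ⟶ 𝒳) [LocallyQuasiFinite e.left] (he : e ≫ f = f)
    (h : ∀ et : fiberOver f t₀ ⟶ fiberOver f t₀, et ≫ fiberι f t₀ = fiberι f t₀ ≫ e →
      ∃ (v : Fin 3 → complexBetti (fiberOver f t₀) (2 * 3)) (μ : Fin 3 → ℂ),
        (∀ i, complexBetti.map et (2 * 3) (v i) = μ i • v i) ∧ Function.Injective μ ∧
        (∀ W : complexBetti 𝒳 (2 * 3),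
          complexBetti.map (fiberι f t₀) (2 * 3) W ∈ Submodule.span ℂ (Set.range v)) ∧
        ∃ Z ∈ algebraicClasses 𝒳 3, ∃ c : Fin 3 → ℂ, (∀ i, c i ≠ 0) ∧
          complexBetti.map (fiberι f t₀) (2 * 3) Z = c 0 • v 0 + c 1 • v 1 + c 2 • v 2) :
    FibreClassLefschetzOn hf :=
  fibreClassLefschetzOn_relDim_six_of_rankOne_of_algebraicInvariantClassesAt_three hf t₀ h2 h4
    (algebraicInvariantClassesAt_of_endOver_of_eigenTriple hf t₀ 3 e he h)

end Summit.HodgeConjecture.HodgeConjecture.Ring2.AbelianAll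

end
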